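import Summits.NavierStokesRegularity.NavierStokesRegularity.Theorems.ExtremiserTransienceKStarAttainedConePotential
import Summits.NavierStokesRegularity.NavierStokesRegularity.Theorems.ExtremiserTransienceKStarAttainedHalfSpaceVariation
import Literature.Analysis.FluidPDE.TaoEnstrophyLocalisation
import Mathlib.Analysis.Calculus.ContDiff.Bounds
import HarnessLib

/-!
# Route `ExtremiserTransience`, crux `RegularisedNearPlateauStability` (stmt-NavierStokesRegularity-28317),
# LINE g8-α «sparse bang-bang»: THE RADIAL (CONE) VECTOR POTENTIAL ABOUT A CENTRE, WITH DERIVATIVE BUDGETS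

`--supports stmt-NavierStokesRegularity-28317` (helper). Author: prover seat `ns-net-p2` (g2).

Step P2 (`RadialPotential`) of `Cruxes/NearExtremalTransiencePerFlow/Lines/sparse_bangbang.lean`, built on the tree's
Poincaré homotopy operator `conePotential v x = ∫₀¹ t·v(tx) × x dt` (`PoincareHomotopyOperator`, `KStar.curl_conePotential`):

* `iteratedFDeriv_parametric_intervalIntegral` — iterated differentiation under the integral sign for a jointly smooth
  integrand on a compact parameter interval (induction on the order via `iteratedFDeriv_succ_eq_comp_right` and the
  tree's one-derivative lemma `FunctionSpaces.hasFDerivAt_parametric_intervalIntegral`);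
* `norm_iteratedFDeriv_coneIntegrand_le`, `norm_iteratedFDeriv_conePotential_le` — under the uniform budget
  `‖Dⁱv‖ ≤ S·M·Lⁱ` (`i ≤ n`, `λL = 1`) and `‖y‖ ≤ ρ₀λ`: `‖Dⁿ(conePotential v)(y)‖ ≤ ‖crossCLM‖·S·M·λ·(ρ₀ + n)·Lⁿ`
  (bilinear Leibniz for `cross`, the chain rule for the dilation `y ↦ ty`, `D^{≥2}(id) = 0`);
* `radialPotential_props` — the potential RE-CENTRED at `c`, `ψ_c(x) = conePotential (v(· + c)) (x − c)`: `C^∞`,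
  `curl ψ_c = v` everywhere (divergence-free `v`), and `‖Dⁿψ_c(x)‖ ≤ ‖crossCLM‖·S·M·λ·(ρ₀+n)·Lⁿ` on `B(c, ρ₀λ)`;
  in particular `‖ψ_c(x)‖ ≤ ‖crossCLM‖·S·M·ρ₀·λ` there — NO Biot–Savart, no decay, no gauge fixing.
HONEST FRAMING: calculus for one explicit integral operator; nothing about Navier–Stokes is proved; no summit is proved
by a line. [folklore]
-/

noncomputable section

open Set Filter Topology MeasureTheory Metric intervalIntegral
open scoped InnerProductSpace RealInnerProductSpace ContDiff
open Literature.Analysis.FluidPDE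
open Summit.NavierStokesRegularity.NavierStokesRegularity.Theorems.DepletionLadder.KStar.HalfSpace

namespace Summit.NavierStokesRegularity.NavierStokesRegularity.Theorems

-- the problem directory repeats the summit name (`NavierStokesRegularity/NavierStokesRegularity`)
set_option linter.dupNamespace false

namespace DepletionLadder.KStar.BangBang

/-! ## 1. Iterated differentiation under the integral sign -/

/-- `D(∫ H(σ,·) dσ) = ∫ D_p H(σ,·) dσ` as functions, for a jointly `C^∞` integrand. [folklore] -/
theorem fderiv_parametric_intervalIntegral_eq {F : Type} [NormedAddCommGroup F] [NormedSpace ℝ F] [CompleteSpace F]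
    {H : ℝ × E3 → F} (hH : ContDiff ℝ ∞ H) (a b : ℝ) :
    fderiv ℝ (fun q : E3 => ∫ σ in a..b, H (σ, q)) =
      fun q => ∫ σ in a..b, (fderiv ℝ H (σ, q)).comp (ContinuousLinearMap.inr ℝ ℝ E3) := by
  have hn : (∞ : WithTop ℕ∞) ≠ 0 := by exact_mod_cast WithTop.coe_ne_zero.2 (by decide)
  funext q
  exact (Literature.Analysis.FunctionSpaces.hasFDerivAt_parametric_intervalIntegral hH hn a b q).fderiv

/-- The partial derivative of a jointly smooth `H` in the second variable is `D H ∘ (0, ·)`. [folklore] -/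
theorem fderiv_slice_eq {F : Type} [NormedAddCommGroup F] [NormedSpace ℝ F] {H : ℝ × E3 → F} (hH : ContDiff ℝ ∞ H)
    (σ : ℝ) : fderiv ℝ (fun q : E3 => H (σ, q)) = fun q => (fderiv ℝ H (σ, q)).comp (ContinuousLinearMap.inr ℝ ℝ E3) := by
  have hn : (∞ : WithTop ℕ∞) ≠ 0 := by exact_mod_cast WithTop.coe_ne_zero.2 (by decide)
  funext q
  exact (Literature.Analysis.FunctionSpaces.hasFDerivAt_comp_prodMk hH hn σ q).fderiv

/-- **Iterated differentiation under the integral sign** on a compact parameter interval, jointly smooth integrand: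
`Dⁿ(p ↦ ∫ₐᵇ H(σ,p) dσ)(p) = ∫ₐᵇ Dⁿ_p H(σ,·)(p) dσ`. [folklore] -/
theorem iteratedFDeriv_parametric_intervalIntegral (a b : ℝ) :
    ∀ (n : ℕ) {F : Type} [NormedAddCommGroup F] [NormedSpace ℝ F] [CompleteSpace F] {H : ℝ × E3 → F},
      ContDiff ℝ ∞ H → ∀ p : E3,
        iteratedFDeriv ℝ n (fun q : E3 => ∫ σ in a..b, H (σ, q)) p =
          ∫ σ in a..b, iteratedFDeriv ℝ n (fun q : E3 => H (σ, q)) p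
  | 0, F, _, _, _, H, hH, p => by
      simp only [iteratedFDeriv_zero_eq_comp, Function.comp_apply]
      exact ((continuousMultilinearCurryFin0 ℝ E3 F).symm.toLinearIsometry.intervalIntegral_comp_comm _).symm
  | n + 1, F, _, _, _, H, hH, p => by
      -- the smooth field of partial derivatives
      set H' : ℝ × E3 → (E3 →L[ℝ] F) := fun z => (fderiv ℝ H z).comp (ContinuousLinearMap.inr ℝ ℝ E3) with hH'def
      have hH' : ContDiff ℝ ∞ H' := (hH.fderiv_right (m := ∞) le_rfl).clm_comp contDiff_const
      have ih := iteratedFDeriv_parametric_intervalIntegral a b n hH' p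
      rw [iteratedFDeriv_succ_eq_comp_right, Function.comp_apply, fderiv_parametric_intervalIntegral_eq hH a b]
      change ((continuousMultilinearCurryRightEquiv' ℝ n E3 F).symm)
          (iteratedFDeriv ℝ n (fun q : E3 => ∫ σ in a..b, H' (σ, q)) p) = _
      rw [ih]
      have hcomm := ((continuousMultilinearCurryRightEquiv' ℝ n E3 F).symm.toLinearIsometry).intervalIntegral_comp_comm
        (a := a) (b := b) (μ := volume) (fun σ => iteratedFDeriv ℝ n (fun q : E3 => H' (σ, q)) p)
      simp only [LinearIsometryEquiv.coe_toLinearIsometry] at hcomm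
      rw [← hcomm]
      refine intervalIntegral.integral_congr fun σ _ => ?_
      rw [iteratedFDeriv_succ_eq_comp_right, Function.comp_apply, fderiv_slice_eq hH σ]

/-- Norm form: if `‖Dⁿ_p H(σ,·)(p)‖ ≤ C` for `σ ∈ [0,1]`, then `‖Dⁿ(∫₀¹ H(σ,·)dσ)(p)‖ ≤ C`. [folklore] -/
theorem norm_iteratedFDeriv_parametric_intervalIntegral_le {F : Type} [NormedAddCommGroup F] [NormedSpace ℝ F]
    [CompleteSpace F] {H : ℝ × E3 → F} (hH : ContDiff ℝ ∞ H) (n : ℕ) (p : E3) {C : ℝ}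
    (hC : ∀ σ ∈ Set.Icc (0 : ℝ) 1, ‖iteratedFDeriv ℝ n (fun q : E3 => H (σ, q)) p‖ ≤ C) :
    ‖iteratedFDeriv ℝ n (fun q : E3 => ∫ σ in (0 : ℝ)..1, H (σ, q)) p‖ ≤ C := by
  rw [iteratedFDeriv_parametric_intervalIntegral 0 1 n hH p]
  have h := intervalIntegral.norm_integral_le_of_norm_le_const (a := (0 : ℝ)) (b := 1) (C := C)
    (f := fun σ => iteratedFDeriv ℝ n (fun q : E3 => H (σ, q)) p) fun σ hσ => hC σ ?_
  · simpa using h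
  · rw [uIoc_of_le zero_le_one] at hσ
    exact ⟨hσ.1.le, hσ.2⟩

/-! ## 2. Derivative budget of the cone integrand and of the cone potential -/

variable {v : E3 → E3}

/-- Derivatives of the identity map: `‖D⁰ id (y)‖ = ‖y‖`, `‖D¹ id‖ ≤ 1`, `D^{k} id = 0` for `k ≥ 2`; packaged as
`‖Dᵏ id (y)‖ ≤ (if k = 0 then ‖y‖ else if k = 1 then 1 else 0)`. [folklore] -/
theorem norm_iteratedFDeriv_id_le (k : ℕ) (y : E3) :
    ‖iteratedFDeriv ℝ k (fun z : E3 => z) y‖ ≤ if k = 0 then ‖y‖ else if k = 1 then 1 else 0 := by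
  rcases k with _ | k
  · simp
  · have hD : fderiv ℝ (fun z : E3 => z) = fun _ => ContinuousLinearMap.id ℝ E3 := by
      funext z; exact fderiv_id
    rw [← norm_iteratedFDeriv_fderiv, hD]
    rcases k with _ | k
    · simp only [norm_iteratedFDeriv_zero, zero_add, one_ne_zero, ↓reduceIte]
      exact ContinuousLinearMap.norm_id_le
    · rw [iteratedFDeriv_const_of_ne (by omega)]
      simp

/-- **Derivative budget of the cone integrand.** If `‖Dⁱv(z)‖ ≤ S·M·Lⁱ` for all `z` and `i ≤ n` (`S, M, L ≥ 0`,
`λ·L = 1`; `S, M, L ≥ 0`), then for `t ∈ [0,1]` and `‖y‖ ≤ ρ₀λ`: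
`‖Dⁿ(y ↦ t·v(ty) × y)(y)‖ ≤ ‖crossCLM‖·S·M·λ·(ρ₀ + n)·Lⁿ`. [folklore] -/
theorem norm_iteratedFDeriv_coneIntegrand_le (hv : ContDiff ℝ ∞ v) {S M L lam ρ₀ : ℝ} (hS : 0 ≤ S) (hM : 0 ≤ M)
    (hL : 0 ≤ L) (hlamL : lam * L = 1) {n : ℕ}
    (hK : ∀ i, i ≤ n → ∀ z, ‖iteratedFDeriv ℝ i v z‖ ≤ S * M * L ^ i) {t : ℝ} (ht : t ∈ Set.Icc (0 : ℝ) 1)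
    {y : E3} (hy : ‖y‖ ≤ ρ₀ * lam) :
    ‖iteratedFDeriv ℝ n (fun z : E3 => t • crossCLM (v (t • z)) z) y‖ ≤ ‖crossCLM‖ * S * M * lam * (ρ₀ + n) * L ^ n := by
  have ht0 : 0 ≤ t := ht.1
  have ht1 : t ≤ 1 := ht.2
  -- the dilated field `z ↦ v (t z)` and its derivatives
  set g : E3 → E3 := fun z => v (t • z) with hgdef
  have hgL : g = v ∘ (t • ContinuousLinearMap.id ℝ E3) := by funext z; simp [hgdef]
  have hg : ContDiff ℝ ∞ g := by rw [hgL]; exact hv.comp (t • ContinuousLinearMap.id ℝ E3).contDiff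
  have hDg : ∀ i, i ≤ n → ‖iteratedFDeriv ℝ i g y‖ ≤ t ^ i * (S * M * L ^ i) := by
    intro i hi
    rw [hgL, ContinuousLinearMap.iteratedFDeriv_comp_right _ hv y (by exact_mod_cast le_top)]
    refine (ContinuousMultilinearMap.norm_compContinuousLinearMap_le _ _).trans ?_
    rw [Finset.prod_const, Finset.card_univ, Fintype.card_fin]
    have hnt : ‖t • ContinuousLinearMap.id ℝ E3‖ ≤ t := by
      rw [norm_smul, Real.norm_of_nonneg ht0]
      exact mul_le_of_le_one_right ht0 ContinuousLinearMap.norm_id_le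
    calc ‖iteratedFDeriv ℝ i v ((t • ContinuousLinearMap.id ℝ E3) y)‖ * ‖t • ContinuousLinearMap.id ℝ E3‖ ^ i
        ≤ (S * M * L ^ i) * t ^ i := mul_le_mul (hK i hi _) (pow_le_pow_left₀ (norm_nonneg _) hnt i) (by positivity)
          (by positivity)
      _ = t ^ i * (S * M * L ^ i) := mul_comm _ _
  -- bilinear Leibniz for `cross`
  have hid : ContDiff ℝ ∞ (fun z : E3 => z) := contDiff_id
  have hLeib := crossCLM.norm_iteratedFDeriv_le_of_bilinear (f := g) (g := fun z : E3 => z) (N := ∞) hg hid y (n := n)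
    (by exact_mod_cast le_top)
  -- the sum has only the terms `i = n` and `i = n - 1`
  have hsum : ∑ i ∈ Finset.range (n + 1), (n.choose i : ℝ) * ‖iteratedFDeriv ℝ i g y‖ *
      ‖iteratedFDeriv ℝ (n - i) (fun z : E3 => z) y‖ ≤ S * M * lam * (ρ₀ + n) * L ^ n := by
    have hterm : ∀ i ∈ Finset.range (n + 1), (n.choose i : ℝ) * ‖iteratedFDeriv ℝ i g y‖ *
        ‖iteratedFDeriv ℝ (n - i) (fun z : E3 => z) y‖ ≤
        (if i = n then S * M * L ^ n * (ρ₀ * lam) else 0) + (if i + 1 = n then n * (S * M * L ^ (n - 1)) else 0) := by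
      intro i hi
      have hin : i ≤ n := Nat.lt_succ_iff.mp (Finset.mem_range.mp hi)
      have hgi : ‖iteratedFDeriv ℝ i g y‖ ≤ S * M * L ^ i :=
        (hDg i hin).trans (mul_le_of_le_one_left (by positivity) (pow_le_one₀ ht0 ht1))
      have hidb := norm_iteratedFDeriv_id_le (n - i) y
      by_cases h1 : i = n
      · subst h1
        simp only [Nat.sub_self, ↓reduceIte, Nat.choose_self, Nat.cast_one, one_mul] at hidb ⊢
        have : ¬ (i + 1 = i) := by omega
        simp only [this, ↓reduceIte, add_zero]
        exact mul_le_mul hgi (hidb.trans hy) (norm_nonneg _) (by positivity)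
      by_cases h2 : i + 1 = n
      · have hni : n - i = 1 := by omega
        rw [hni] at hidb
        simp only [one_ne_zero, ↓reduceIte] at hidb
        simp only [h1, ↓reduceIte, h2, zero_add]
        have hch : (n.choose i : ℝ) = n := by
          rw [← h2, Nat.choose_succ_self_right]
        rw [hch, hni]
        have hi' : i = n - 1 := by omega
        subst hi'
        calc (n : ℝ) * ‖iteratedFDeriv ℝ (n - 1) g y‖ * ‖iteratedFDeriv ℝ 1 (fun z : E3 => z) y‖
            ≤ (n : ℝ) * (S * M * L ^ (n - 1)) * 1 := by
              exact mul_le_mul (mul_le_mul_of_nonneg_left hgi (Nat.cast_nonneg _)) hidb (norm_nonneg _) (by positivity)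
          _ = n * (S * M * L ^ (n - 1)) := mul_one _
      · have hni : n - i ≠ 0 ∧ n - i ≠ 1 := ⟨by omega, by omega⟩
        simp only [hni.1, hni.2, ↓reduceIte] at hidb
        have h0 : ‖iteratedFDeriv ℝ (n - i) (fun z : E3 => z) y‖ = 0 := le_antisymm hidb (norm_nonneg _)
        simp only [h0, mul_zero, h1, h2, ↓reduceIte, add_zero, le_refl]
    refine (Finset.sum_le_sum hterm).trans ?_
    rw [Finset.sum_add_distrib, Finset.sum_ite_eq' , Finset.sum_ite]
    simp only [Finset.mem_range, Nat.lt_succ_self, ↓reduceIte, Finset.sum_const_zero, add_zero]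
    -- the second sum: at most one term
    rcases Nat.eq_zero_or_pos n with hn0 | hnpos
    · subst hn0
      simp only [Nat.cast_zero, add_zero, pow_zero, mul_one, zero_mul, Finset.sum_const, smul_zero]
      nlinarith
    · have hfilter : (Finset.range (n + 1)).filter (fun i => i + 1 = n) = {n - 1} := by
        ext i
        simp only [Finset.mem_filter, Finset.mem_range, Finset.mem_singleton]
        constructor
        · rintro ⟨-, h⟩; omega
        · intro h; subst h; constructor <;> omega
      rw [hfilter, Finset.sum_singleton]
      have hLn : L ^ (n - 1) = L ^ n * lam := by
        have : L ^ n = L ^ (n - 1) * L := by rw [← pow_succ]; congr 1; omega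
        rw [this, mul_assoc, mul_comm L lam, hlamL, mul_one]
      rw [hLn]
      have : S * M * L ^ n * (ρ₀ * lam) + n * (S * M * (L ^ n * lam)) = S * M * lam * (ρ₀ + n) * L ^ n := by ring
      rw [this]
  -- assemble: pull out the scalar `t`
  have hsmul : (fun z : E3 => t • crossCLM (v (t • z)) z) = fun z => t • (fun w : E3 => crossCLM (g w) w) z := by
    funext z; simp [hgdef]
  rw [hsmul]
  have hcg : ContDiff ℝ ∞ (fun w : E3 => crossCLM (g w) w) := (crossCLM.contDiff.comp hg).clm_apply hid
  rw [iteratedFDeriv_const_smul_apply' (hcg.contDiffAt.of_le (by exact_mod_cast le_top)), norm_smul,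
    Real.norm_of_nonneg ht0]
  have hc0 : 0 ≤ ‖crossCLM‖ := norm_nonneg crossCLM
  calc t * ‖iteratedFDeriv ℝ n (fun w : E3 => crossCLM (g w) w) y‖
      ≤ 1 * (‖crossCLM‖ * (S * M * lam * (ρ₀ + n) * L ^ n)) := by
        refine mul_le_mul ht1 (hLeib.trans (mul_le_mul_of_nonneg_left hsum hc0)) (norm_nonneg _) zero_le_one
    _ = ‖crossCLM‖ * S * M * lam * (ρ₀ + n) * L ^ n := by ring

/-- **Derivative budget of the cone potential** on the ball `‖y‖ ≤ ρ₀λ`: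
`‖Dⁿ(conePotential v)(y)‖ ≤ ‖crossCLM‖·S·M·λ·(ρ₀ + n)·Lⁿ`. [folklore] -/
theorem norm_iteratedFDeriv_conePotential_le (hv : ContDiff ℝ ∞ v) {S M L lam ρ₀ : ℝ} (hS : 0 ≤ S) (hM : 0 ≤ M)
    (hL : 0 ≤ L) (hlamL : lam * L = 1) {n : ℕ}
    (hK : ∀ i, i ≤ n → ∀ z, ‖iteratedFDeriv ℝ i v z‖ ≤ S * M * L ^ i) {y : E3} (hy : ‖y‖ ≤ ρ₀ * lam) :
    ‖iteratedFDeriv ℝ n (conePotential v) y‖ ≤ ‖crossCLM‖ * S * M * lam * (ρ₀ + n) * L ^ n := by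
  have h1 : ContDiff ℝ ∞ fun q : ℝ × E3 => v (q.1 • q.2) := hv.comp (contDiff_fst.smul contDiff_snd)
  have hH : ContDiff ℝ ∞ fun q : ℝ × E3 => q.1 • crossCLM (v (q.1 • q.2)) q.2 :=
    contDiff_fst.smul ((crossCLM.contDiff.comp h1).clm_apply contDiff_snd)
  have heq : conePotential v = fun p : E3 => ∫ σ in (0 : ℝ)..1, σ • crossCLM (v (σ • p)) p := by
    funext p; rfl
  rw [heq]
  exact norm_iteratedFDeriv_parametric_intervalIntegral_le hH n y fun σ hσ =>
    norm_iteratedFDeriv_coneIntegrand_le hv hS hM hL hlamL hK hσ hy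

/-! ## 3. The re-centred potential `ψ_c(x) = conePotential (v(· + c)) (x − c)` -/

/-- **The radial potential about a centre `c`.** For a smooth divergence-free field `v` with the uniform budget
`‖Dⁱv‖ ≤ S·M·Lⁱ` (`i ≤ n`, `λL = 1`), the field `ψ_c(x) = conePotential (v(· + c)) (x − c)` is `C^∞`, satisfies
`curl ψ_c = v` EVERYWHERE, and on the ball `B(c, ρ₀λ)` obeys `‖Dᵏψ_c(x)‖ ≤ ‖crossCLM‖·S·M·λ·(ρ₀ + k)·Lᵏ` for every
`k ≤ n` (so `‖ψ_c‖ ≤ ‖crossCLM‖·S·M·ρ₀·λ` there). [folklore] -/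
theorem radialPotential_props (hv : ContDiff ℝ ∞ v) (hdiv : VectorCalculus.IsDivFree v) (c : E3) {S M L lam ρ₀ : ℝ}
    (hS : 0 ≤ S) (hM : 0 ≤ M) (hL : 0 ≤ L) (hlamL : lam * L = 1) {n : ℕ}
    (hK : ∀ i, i ≤ n → ∀ z, ‖iteratedFDeriv ℝ i v z‖ ≤ S * M * L ^ i) :
    ContDiff ℝ ∞ (fun x => conePotential (fun y => v (y + c)) (x - c)) ∧
      (∀ x, curl (fun x => conePotential (fun y => v (y + c)) (x - c)) x = v x) ∧
      ∀ k, k ≤ n → ∀ x, dist x c ≤ ρ₀ * lam →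
        ‖iteratedFDeriv ℝ k (fun x => conePotential (fun y => v (y + c)) (x - c)) x‖ ≤
          ‖crossCLM‖ * S * M * lam * (ρ₀ + k) * L ^ k := by
  set w : E3 → E3 := fun y => v (y + c) with hwdef
  have hw : ContDiff ℝ ∞ w := hv.comp (contDiff_id.add contDiff_const)
  have hwdiv : VectorCalculus.IsDivFree w := by
    intro y
    simp only [VectorCalculus.divergence, hwdef, fderiv_comp_add_right]
    exact hdiv (y + c)
  have hP : ContDiff ℝ ∞ (conePotential w) := contDiff_conePotential hw
  have hKw : ∀ i, i ≤ n → ∀ z, ‖iteratedFDeriv ℝ i w z‖ ≤ S * M * L ^ i := by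
    intro i hi z
    rw [hwdef, iteratedFDeriv_comp_add_right]
    exact hK i hi _
  refine ⟨hP.comp (contDiff_id.sub contDiff_const), fun x => ?_, fun k hk x hx => ?_⟩
  · have hD : fderiv ℝ (fun x => conePotential w (x - c)) x = fderiv ℝ (conePotential w) (x - c) := by
      simpa [sub_eq_add_neg] using fderiv_comp_add_right (f := conePotential w) (-c) (x := x)
    rw [curl_eq_curlCLM, hD, ← curl_eq_curlCLM, curl_conePotential hw hwdiv (x - c)]
    simp [hwdef]
  · rw [iteratedFDeriv_comp_sub]
    refine norm_iteratedFDeriv_conePotential_le hw hS hM hL hlamL (fun i hi z => hKw i (hi.trans hk) z) ?_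
    rwa [← dist_eq_norm]

end DepletionLadder.KStar.BangBang

end Summit.NavierStokesRegularity.NavierStokesRegularity.Theorems

end
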